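import Summits.HodgeConjecture.HodgeConjecture.Theses.KulikovCuspKugaSatake

/-!
# Crux-strategist audit — `KulikovCuspKugaSatake.SectorComplement` (stmt-HodgeConjecture-18399):
# exact logical status of the declared residual, kernel-checked for THIS decl

The suspect-equivalence detector cited `nikulinTwinTransport_sectorComplement_iff_hodgeConjecture`
(`Theorems/NikulinTwinTransportSectorComplement.lean:89`), which concerns the HOMONYMOUS decl
`NikulinTwinTransport.SectorComplement := SquareHodgeOfSqrtTwo → HodgeConjecture` (stmt-13684), not this
item. This file records the corresponding facts for
`KulikovCuspKugaSatake.SectorComplement := KugaSatakeWittTwo → HodgeConjecture` with no hypothesis beyond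
the route's own declarations:

* `sector_of_siblings` : `RankSixBase → NLAnchor → CuspStep → KugaSatakeWittTwo` — the route's three
  sector items deliver the sector (strong induction on `r = rk T(S)_ℚ`, the proof text of `closes`);
* `sectorComplement_of_summit` : `HodgeConjecture → SectorComplement` (the residual is a consequence of S);
* `sectorComplement_iff_summit_of_sector` : `KugaSatakeWittTwo → (SectorComplement ↔ HodgeConjecture)`;
* `sectorComplement_iff_summit_of_siblings` : given the three sector items, `SectorComplement ↔ HodgeConjecture`
  — the "B ↔ S given the route's other cruxes" the detector suspects, for the right decl;
* `sectorComplement_iff` : `SectorComplement ↔ (¬ KugaSatakeWittTwo ∨ HodgeConjecture)` and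
  `not_sectorComplement_iff` : `¬ SectorComplement ↔ KugaSatakeWittTwo ∧ ¬ HodgeConjecture` (truth table);
* `summit_of_sector_and_complement` : `KugaSatakeWittTwo ∧ SectorComplement → HodgeConjecture` (the conjunct
  split the route declares: attacked conjunct = the sector, `residual: SectorComplement`).

NOT provable here (and not claimed): `HodgeConjecture → KugaSatakeWittTwo`. Unlike the Nikulin sector
(`HodgeConjectureFor 4 (S ⊗ S)`, a verbatim instance of the summit), the Kuga–Satake sector is typed in the
operator currency of an abstract classical Betti–Hodge datum `B` (`B.IsKSCorrespondenceAlgebraic`: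
`∃ O, B.W.IsAlgebraicOperator 2 (g+g) O ∧ O ∘ j = κ`); deducing it from the real-carrier statement
`HodgeTheory.HodgeConjectureFor` needs the classical → `B` direction of the period bridge (Künneth + cycle
class comparison inside `B.IsClassical`), which the tree does not have (`IsClassical.hodgeConjectureFor` is the
`B` → classical direction only). So `HodgeConjecture ↔ KugaSatakeWittTwo ∧ SectorComplement` is NOT
kernel-available for this route; only the direction `←` is.
-/

namespace Summit.HodgeConjecture.HodgeConjecture.Cruxes.SectorComplement.EquivalenceAudit18399

open Summit.HodgeConjecture.HodgeConjecture.Theses.KulikovCuspKugaSatake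

/-- The three sector items deliver the sector: strong induction on the transcendental rank
(verbatim the logic of the route's `closes`). [folklore] -/
theorem sector_of_siblings (hBase : RankSixBase) (hNL : NLAnchor) (hCusp : CuspStep) :
    KugaSatakeWittTwo := by
  intro B hB r
  induction r using Nat.strong_induction_on with
  | _ r ih =>
    rcases Nat.lt_or_ge r 7 with hr | hr
    · exact hBase B hB r (by omega)
    · exact hCusp B hB r hr (hNL B hB r ih)

/-- The residual is a consequence of the summit. [folklore] -/
theorem sectorComplement_of_summit : _root_.HodgeConjecture → SectorComplement :=
  fun h _ ↦ h

/-- Given the sector, the residual IS the summit. [folklore] -/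
theorem sectorComplement_iff_summit_of_sector (hK : KugaSatakeWittTwo) :
    SectorComplement ↔ _root_.HodgeConjecture :=
  ⟨fun h ↦ h hK, fun h _ ↦ h⟩

/-- Given the route's other three load-bearing items, the residual IS the summit — the detector's
"B ↔ S given the other cruxes", for `KulikovCuspKugaSatake.SectorComplement`. [folklore] -/
theorem sectorComplement_iff_summit_of_siblings (hBase : RankSixBase) (hNL : NLAnchor)
    (hCusp : CuspStep) : SectorComplement ↔ _root_.HodgeConjecture :=
  sectorComplement_iff_summit_of_sector (sector_of_siblings hBase hNL hCusp)

/-- Truth table of the residual. [folklore] -/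
theorem sectorComplement_iff :
    SectorComplement ↔ (¬ KugaSatakeWittTwo ∨ _root_.HodgeConjecture) := by
  constructor
  · intro h
    by_cases hK : KugaSatakeWittTwo
    · exact Or.inr (h hK)
    · exact Or.inl hK
  · rintro (hK | hHC) hK'
    · exact absurd hK' hK
    · exact hHC

/-- What a refutation of the residual would be: the whole sector AND a disproof of the summit. [folklore] -/
theorem not_sectorComplement_iff :
    ¬ SectorComplement ↔ KugaSatakeWittTwo ∧ ¬ _root_.HodgeConjecture :=
  Classical.not_imp

/-- The conjunct split the route declares (attacked conjunct = the sector, residual = the complement). [folklore] -/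
theorem summit_of_sector_and_complement (h : KugaSatakeWittTwo ∧ SectorComplement) :
    _root_.HodgeConjecture :=
  h.2 h.1

/-- The route's deciding theorem re-derived from the two lemmas above (sanity: same binders as `closes`). [folklore] -/
theorem closes' (hBase : RankSixBase) (hNL : NLAnchor) (hCusp : CuspStep) (hC : SectorComplement) :
    _root_.HodgeConjecture :=
  summit_of_sector_and_complement ⟨sector_of_siblings hBase hNL hCusp, hC⟩

end Summit.HodgeConjecture.HodgeConjecture.Cruxes.SectorComplement.EquivalenceAudit18399
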